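import Summits.QuantumFields.YangMills.Theorems.UV3UnitEnvelopeLinOfPartialIterates
import Summits.QuantumFields.YangMills.Theorems.UV3PinnedStepOrganOfGrowingPartialIterates
import HarnessLib

/-!
# R3 (cell `ym3-torus`, YM₃ on T³ — a ladder RUNG, NOT d = 4, NOT infinite volume, NOT a mass gap, NOT the Clay problem) —
# **R-19936-U: THE UNIT ENVELOPE WITH AN ARBITRARY RUN-DEPENDENT SLACK `s_K`, `ρ_K ≤ s_K·e^{Cl}·Z_K` a.e., FROM A MASS ENVELOPE `m_K(r,·) ≤ s_K·e^{A₁}`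
# ON EVERY HISTORY; INSTANCE `s_K = e^{A₂K}` FROM hTop♭ ∕ hPI♭** (the U-side companion of ✓`UV3PinnedStepOrganOfGrowingPartialIterates`; feeds LEAD's door
# ✓`UnitScaleTiltPinnedHeightTailDoorExpSlack.pinnedHeightTail_of_exp'`)

Seat `ym-ust-19936-w5` g18 (WIDTH-5 helper on stmt-QuantumFields-19936 `HistoryTailL`; NO claim on crux ∕ stub ∕ registry; LEAD ★w1 g11 01:14:11Z «w5: GO U♭»).
THEOREMS ONLY (0 `def`, 0 `sorry`); `--supports stmt-QuantumFields-19936 --as helper`; count-neutral; CONDITIONAL on the v1 (α) socket `AlphaInputsT3AC.Of F 𝔠`,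
the main-term row `hMain` and the displayed kinematic row.

THE POINT.  LEAD K-22 (✓`UV3UnitEnvelopeLinOfPartialIterates`) and w3 g19's K-23-TOP §1 carry the slack `K + 1` of the v1 masses through the U organ: mass envelope
`(K+1)e^{A₁}` on every history ⟹ leaf `LF_K ≤ (K+1)e^{CZ}` ⟹ `ρ_K ≤ (K+1)e^{−Ecst_K + Cu'}` ⟹ (halves) `ρ_K ≤ (K+1)e^{Cl'}Z_K` a.e.  Nothing in that chain uses the
shape of the factor: §1–§4 below run it for an ARBITRARY non-negative (resp. positive) run-dependent slack `s : ℕ → ℝ` — K-22 §1 ✓`top_le_of_massEnvelopeAll` at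
`Menv := s_K·e^{A₁}`, K-22 §3's one-run reading ✓`ae_emlDensity_top_le_of_rows_ae_at` at `CZ + log s_K`, and the halves knit with the factor carried.  §5 instantiates
`s_K := e^{A₂K}`: the `K`-linear log-envelope hJ♭-for-every-history (✓`AlphaInputsT3AC.Of.growingMassEnvelopeAll_of_growingTopHaarPushforward` from hTop♭, resp.
`…_of_growingPartialIterates` from hPI♭) gives **`∃ Cl A₂, 0 ≤ A₂ ∧ ∀ K, ρ_K ≤ e^{A₂K}·(e^{Cl}·Z_K)` a.e.** — the `hLowExp` letter of LEAD's K-24 door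
✓`pinnedHeightTail_of_exp'` per `(F, γ)` — so the guarded crux face over hTop♭ is one composition away (next file).

CONTENTS: §1 ★★ `AlphaInputsT3AC.Of.hlfSlack_of_slackMassEnvelopeAll` · §2 ★★ `…Of.ae_emlDensity_top_le_slack_of_hlfSlack` · §3 `unitEnvelope_of_halves_slack` · §4 ★★★
`…Of.unitEnvelopeSlack_of_slackMassEnvelopeAll_of_main` · §5 `…Of.slackMassEnvelopeAll_of_growingMassEnvelopeAll` (`e^{A₁+A₂K} ≤ e^{A₂⁺K}·e^{A₁}`), ★★★
`…Of.unitEnvelopeExp_of_growingMassEnvelopeAll_of_main`, ★★★ `…Of.unitEnvelopeExp_of_growingTopHaarPushforward_of_main`, ★★ `…Of.unitEnvelopeExp_of_growingPartialIterates_of_main`.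

HONEST SCOPE.  Bookkeeping over landed theorems; hTop♭ ∕ hPI♭ and `hMain` are DISPLAYED (hypotheses), NOT proved; this is NOT the registered `stub_unitEnvelope` (K-uniform letter)
but a weaker letter the history-tail door tolerates (K-24); nothing of `stub_pinnedStep`, `stub_unitEnvelope`, `hP′`, `HistoryTailL` (19936), the rung `YM3TorusSU2`, any continuum
limit, d = 4, a mass gap or Clay is proved here; no summit statement is proved by this seat.

References: T. Bałaban, Commun. Math. Phys. **102** (1985) 255–275 [Balaban1985UV3] ((41) p. 266, (46)–(47) p. 267, (5)–(6) pp. 256–257, pp. 273–274); T. Bałaban, Commun.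
Math. Phys. **98** (1985) 17–51 [Balaban1985Averaging] ((15) p. 19); T. Bałaban, Commun. Math. Phys. **109** (1987) 249–301 [Balaban1987RG1] ((0.11) p. 253).
-/

set_option autoImplicit false

noncomputable section

namespace Summit.QuantumFields.YangMills.Theorems.UV3UnitEnvelopeSlackOfMassEnvelope

open MeasureTheory
open scoped BigOperators ENNReal
open Literature.MathematicalPhysics.QuantumFieldTheory.Balaban1983to89
open Literature.MathematicalPhysics.QuantumFieldTheory.Balaban1983to89.T3ContinuumYM3Torus
open Literature.MathematicalPhysics.QuantumFieldTheory.Balaban1983to89.T3UnitLawDensityEML (ℰp emlDensity)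
open Literature.MathematicalPhysics.QuantumFieldTheory.Balaban1983to89.T3UnitScaleTilt (θBal)
open Literature.MathematicalPhysics.QuantumFieldTheory.Balaban1983to89.T3RestrictedUnitDensity (resDensity)
open Literature.MathematicalPhysics.QuantumFieldTheory.Balaban1983to89.T3AlphaInputsAC
open Literature.MathematicalPhysics.QuantumFieldTheory.Balaban1983to89.T4AvgSensitivity (iterFrom)
open Literature.MathematicalPhysics.QuantumFieldTheory.Balaban1985CMP102
open Literature.MathematicalPhysics.QuantumFieldTheory.Balaban1985CMP102.Setting
open Literature.MathematicalPhysics.QuantumFieldTheory.Balaban1983to89.Missing (partitionFn)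
open Summit.QuantumFields.Balaban3D.Carriers
open Summit.QuantumFields.Balaban3D.Proofs.Primitives
open Summit.QuantumFields.Balaban3D.Proofs.TowerAC
open Summit.QuantumFields.Balaban3D.Proofs.StandardAC
open Summit.QuantumFields.Balaban3D.Proofs.InputsAC
open Summit.QuantumFields.YangMills.Theorems.UV3UnitEnvelopeLinOfPartialIterates (top_le_of_massEnvelopeAll ae_emlDensity_top_le_of_rows_ae_at)

variable {F : T3Family} {𝔠 : AlphaConsts F.L (suGroupModel 2).N}
  (h : AlphaInputsT3AC.Of F 𝔠) (γ : ℝ) (hγ : 0 < γ) (hγ1 : γ ≤ (min 𝔠.gamma0 1) ^ 2) (π : AlphaInputsT3AC.PolymerT3 F)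

/-! ## §1 The top-level un-pinned leaf with slack `s_K` from a mass envelope `s_K·e^{A₁}` on every history -/

/-- ★★ **THE TOP-LEVEL UN-PINNED LEAF WITH SLACK `s_K` FROM A MASS ENVELOPE `s_K·e^{A₁}` ON EVERY HISTORY** (the trivial one included; `s_K ≥ 0`): K-22 §1
✓`top_le_of_massEnvelopeAll` at `Menv := s_K·e^{A₁}` gathered over the finitely many histories (`LF = Σ_r m_r·e^{Φ(r)}` by `rfl`); `CZ := A₁ + (3∕ℓ)(2L^m)³`.  K-23-TOP's
✓`hlfLin_of_linMassEnvelopeAll` is the case `s_K = K + 1`. [cite: Balaban1985UV3, (41) p.266, (5) p.257, pp.273–274] -/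
theorem _root_.Summit.QuantumFields.YangMills.Theorems.AlphaInputsT3AC.Of.hlfSlack_of_slackMassEnvelopeAll (s : ℕ → ℝ) (hs : ∀ K, 0 ≤ s K)
    (hEnv : ∃ A₁ : ℝ, ∀ (K : ℕ) (r : Hist (F.P K) K),
      ∀ᵐ W ∂(fieldMeasure (F.P K) K (Matrix.specialUnitaryGroup (Fin 2) ℂ)),
        (inputOfAC 𝔠.lane (h.pkgAt γ hγ hγ1 K).X (h.pkgAt γ hγ hγ1 K).𝔖).W.mass K r W ≤ s K * Real.exp A₁) :
    ∃ CZ : ℝ, ∀ K : ℕ, ∀ᵐ W ∂fieldMeasure (F.P K) K (Matrix.specialUnitaryGroup (Fin 2) ℂ),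
      (h.dataT3 γ hγ hγ1 π).LF K K W
          (fun hh => -((h.dataT3 γ hγ hγ1 π).mainT K K hh W) + (h.dataT3 γ hγ hγ1 π).Zterm K K hh) ≤ s K * Real.exp CZ := by
  obtain ⟨A₁, hA⟩ := hEnv
  refine ⟨A₁ + 3 / (Real.log F.L / 2) * (2 * (F.L : ℝ) ^ F.m) ^ 3, fun K => ?_⟩
  have hae : ∀ᵐ W ∂fieldMeasure (F.P K) K (Matrix.specialUnitaryGroup (Fin 2) ℂ), ∀ r : Hist (F.P K) K,
      (inputOfAC 𝔠.lane (h.pkgAt γ hγ hγ1 K).X (h.pkgAt γ hγ hγ1 K).𝔖).W.mass K r W ≤ s K * Real.exp A₁ :=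
    ae_all_iff.2 fun r => hA K r
  filter_upwards [hae] with W hW
  have hK1 : (0 : ℝ) ≤ s K * Real.exp A₁ := mul_nonneg (hs K) (Real.exp_pos _).le
  have h1 := top_le_of_massEnvelopeAll (h.pkgAt γ hγ hγ1 K) hK1 W (fun r _ => hW r)
  calc (h.dataT3 γ hγ hγ1 π).LF K K W
          (fun hh => -((h.dataT3 γ hγ hγ1 π).mainT K K hh W) + (h.dataT3 γ hγ hγ1 π).Zterm K K hh)
        = ∑ r : Hist (F.P K) K, (inputOfAC 𝔠.lane (h.pkgAt γ hγ hγ1 K).X (h.pkgAt γ hγ hγ1 K).𝔖).W.mass K r W *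
            Real.exp (-((h.pkgAt γ hγ hγ1 K).T.mainT K r W) + (h.pkgAt γ hγ hγ1 K).T.Zterm K r) := rfl
    _ ≤ s K * Real.exp A₁ * Real.exp (3 / (Real.log F.L / 2) * (2 * (F.L : ℝ) ^ F.m) ^ 3) := h1
    _ = s K * Real.exp (A₁ + 3 / (Real.log F.L / 2) * (2 * (F.L : ℝ) ^ F.m) ^ 3) := by
        rw [Real.exp_add]; ring

/-! ## §2 (U″) with slack `s_K` from the leaf -/

/-- ★★ **(U″) WITH SLACK `s_K > 0` FROM THE LEAF**: `LF_K ≤ s_K·e^{CZ}` a.e. (every run) ⇒ `∃ Cu', ∀ K, ρ_K ≤ s_K·exp(−Ecst_K + Cu')` `dV_K`-a.e. — K-22 §3's one-run reading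
✓`ae_emlDensity_top_le_of_rows_ae_at` at `CZ + log s_K`, rows BY NAME ((41)′ ✓`dataT3_ineq41AE`, shape ✓`dataT3_lfShape`, remainder ✓`dataT3_exp_two_Rm_le` + `Rm_nonneg ∘
dataT3_rmSize`, (46) ✓`abs_dataT3_Pint_top_le`).  K-23-TOP's ✓`ae_emlDensity_top_le_lin_of_hlfLin` is the case `s_K = K + 1`. [cite: Balaban1985UV3, (41) p.266, (46) p.267, (5) p.256, pp.273–274] -/
theorem _root_.Summit.QuantumFields.YangMills.Theorems.AlphaInputsT3AC.Of.ae_emlDensity_top_le_slack_of_hlfSlack (s : ℕ → ℝ) (hs : ∀ K, 0 < s K)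
    (hlf : ∃ CZ : ℝ, ∀ K : ℕ, ∀ᵐ W ∂fieldMeasure (F.P K) K (Matrix.specialUnitaryGroup (Fin 2) ℂ),
      (h.dataT3 γ hγ hγ1 π).LF K K W
          (fun hh => -((h.dataT3 γ hγ hγ1 π).mainT K K hh W) + (h.dataT3 γ hγ hγ1 π).Zterm K K hh) ≤ s K * Real.exp CZ) :
    ∃ Cu' : ℝ, ∀ K : ℕ, ∀ᵐ W ∂fieldMeasure (F.P K) K (Matrix.specialUnitaryGroup (Fin 2) ℂ),
      emlDensity F γ K K W ≤ s K * Real.exp (-((h.dataT3 γ hγ hγ1 π).Ecst K K) + Cu') := by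
  obtain ⟨CZ, hCZ⟩ := hlf
  obtain ⟨CRm, hCRm⟩ := h.dataT3_exp_two_Rm_le γ hγ hγ1 π
  have hCRm0 : 0 < CRm := (Real.exp_pos _).trans_le (hCRm 0 0 le_rfl)
  have hRm : ∀ K : ℕ, (h.dataT3 γ hγ hγ1 π).Rm K K ≤ Real.log CRm := fun K => by
    have h2 : Real.exp (2 * (h.dataT3 γ hγ hγ1 π).Rm K K) ≤ CRm := hCRm K K le_rfl
    have h0 : 0 ≤ (h.dataT3 γ hγ hγ1 π).Rm K K := Rm_nonneg (h.dataT3_rmSize γ hγ hγ1 π) le_rfl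
    have h1 : Real.exp ((h.dataT3 γ hγ hγ1 π).Rm K K) ≤ Real.exp (2 * (h.dataT3 γ hγ hγ1 π).Rm K K) :=
      Real.exp_le_exp.mpr (by linarith)
    exact (Real.le_log_iff_exp_le hCRm0).mpr (h1.trans h2)
  refine ⟨Real.log CRm + 𝔠.C46 * (𝔠.M₁ : ℝ) ^ 3 * θBal F.L γ 𝔠.b₀ 𝔠.p₀ 1 ^ 2 * (2 * (F.L : ℝ) ^ F.m) ^ 3 + CZ, fun K => ?_⟩
  have hsK : 0 < s K := hs K
  have hlfK : ∀ᵐ W ∂fieldMeasure (F.P K) K (Matrix.specialUnitaryGroup (Fin 2) ℂ),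
      (h.dataT3 γ hγ hγ1 π).LF K K W
          (fun hh => -((h.dataT3 γ hγ hγ1 π).mainT K K hh W) + (h.dataT3 γ hγ hγ1 π).Zterm K K hh) ≤
        Real.exp (CZ + Real.log (s K)) := by
    filter_upwards [hCZ K] with W hW
    rw [Real.exp_add, Real.exp_log hsK, mul_comm]
    exact hW
  have hat := ae_emlDensity_top_le_of_rows_ae_at (h.dataT3 γ hγ hγ1 π) K (h.dataT3_ineq41AE γ hγ hγ1 π K K le_rfl)
    (fun W Φ Ψ hle => (h.dataT3_lfShape γ hγ hγ1 π).1 K K W Φ Ψ hle)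
    (fun W Φ t => (h.dataT3_lfShape γ hγ hγ1 π).2 K K W Φ t) (hRm K)
    (fun hh W => (abs_le.mp (h.abs_dataT3_Pint_top_le γ hγ hγ1 π K hh W)).2) hlfK
  filter_upwards [hat] with W hW
  refine hW.trans (le_of_eq ?_)
  rw [show -((h.dataT3 γ hγ hγ1 π).Ecst K K) +
        (Real.log CRm + 𝔠.C46 * (𝔠.M₁ : ℝ) ^ 3 * θBal F.L γ 𝔠.b₀ 𝔠.p₀ 1 ^ 2 * (2 * (F.L : ℝ) ^ F.m) ^ 3 +
          (CZ + Real.log (s K))) =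
      (-((h.dataT3 γ hγ hγ1 π).Ecst K K) +
        (Real.log CRm + 𝔠.C46 * (𝔠.M₁ : ℝ) ^ 3 * θBal F.L γ 𝔠.b₀ 𝔠.p₀ 1 ^ 2 * (2 * (F.L : ℝ) ^ F.m) ^ 3 + CZ)) +
        Real.log (s K) by ring,
    Real.exp_add, Real.exp_log hsK, mul_comm]

/-! ## §3 The halves knit with slack `s_K` -/

omit h π in
/-- **THE TWO HALVES WITH SLACK `s_K ≥ 0`**: `ρ_K ≤ s_K·e^{−E_K + Cu'}` a.e. (upper) and `e^{−E_K − Cl} ≤ ∫ρ_K = Z_K` (lower, ✓`integral_emlDensity_eq_partitionFn`) give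
`ρ_K ≤ s_K·(e^{Cu'+Cl}·Z_K)` a.e. — K-22 §4 ✓`unitEnvelope_of_halves_lin` with an arbitrary factor. [cite: Balaban1985UV3, (5)–(6) pp.256–257, (41) p.266, (47) p.267] -/
theorem unitEnvelope_of_halves_slack (F : T3Family) {γ : ℝ} (hγ : 0 ≤ γ) (s : ℕ → ℝ) (hs : ∀ K, 0 ≤ s K) (E : ℕ → ℝ)
    (hU : ∃ Cu' : ℝ, ∀ K : ℕ, ∀ᵐ V ∂fieldMeasure (F.P K) K (Matrix.specialUnitaryGroup (Fin 2) ℂ),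
      emlDensity F γ K K V ≤ s K * Real.exp (-E K + Cu'))
    (hL : ∃ Cl : ℝ, ∀ K : ℕ,
      Real.exp (-E K - Cl) ≤ ∫ V, emlDensity F γ K K V ∂fieldMeasure (F.P K) K (Matrix.specialUnitaryGroup (Fin 2) ℂ)) :
    ∃ Cl' : ℝ, ∀ K : ℕ, ∀ᵐ V ∂fieldMeasure (F.P K) K (Matrix.specialUnitaryGroup (Fin 2) ℂ),
      emlDensity F γ K K V ≤
        s K * (Real.exp Cl' * partitionFn (G := Matrix.specialUnitaryGroup (Fin 2) ℂ) (F.P K) ((F.scheme ℰp γ).β K)) := by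
  obtain ⟨Cu', hCu⟩ := hU
  obtain ⟨Cl, hCl⟩ := hL
  refine ⟨Cu' + Cl, fun K => ?_⟩
  have hZ : Real.exp (-E K - Cl) ≤
      partitionFn (G := Matrix.specialUnitaryGroup (Fin 2) ℂ) (F.P K) ((F.scheme ℰp γ).β K) := by
    rw [← UV3PinnedRatioOfTowerBounds.integral_emlDensity_eq_partitionFn F K hγ K (Nat.le_add_left K F.m)]
    exact hCl K
  filter_upwards [hCu K] with V hV
  calc emlDensity F γ K K V ≤ s K * Real.exp (-E K + Cu') := hV
    _ = s K * (Real.exp (Cu' + Cl) * Real.exp (-E K - Cl)) := by rw [← Real.exp_add]; ring_nf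
    _ ≤ s K * (Real.exp (Cu' + Cl) *
          partitionFn (G := Matrix.specialUnitaryGroup (Fin 2) ℂ) (F.P K) ((F.scheme ℰp γ).β K)) :=
        mul_le_mul_of_nonneg_left (mul_le_mul_of_nonneg_left hZ (Real.exp_pos _).le) (hs K)

/-! ## §4 The unit envelope with slack `s_K`, per `(F, γ)`, from the socket, `hMain` and the envelope -/

/-- ★★★ **THE UNIT ENVELOPE WITH SLACK `s_K > 0`, PER `(F, γ)`, FROM THE (α) SOCKET, THE MAIN-TERM ROW AND A MASS ENVELOPE `s_K·e^{A₁}` ON EVERY HISTORY**: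
`∃ Cl', ∀ K, ρ_K ≤ s_K·(e^{Cl'}·Z_K)` `dV_K`-a.e. — §1, §2 (upper) and ✓`AlphaInputsT3AC.Of.exp_Ecst_le_partitionFn_of_package_of_main (hMain)` (lower), knit by §3.
K-23-TOP's ✓`unitEnvelopeLin_of_hlfLin_of_main` is the case `s_K = K + 1`. [cite: Balaban1985UV3, Thm 1 (5)–(6) pp.256–257, (41) p.266, (46)–(47) p.267, pp.273–274] -/
theorem _root_.Summit.QuantumFields.YangMills.Theorems.AlphaInputsT3AC.Of.unitEnvelopeSlack_of_slackMassEnvelopeAll_of_main (s : ℕ → ℝ) (hs : ∀ K, 0 < s K)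
    (hEnv : ∃ A₁ : ℝ, ∀ (K : ℕ) (r : Hist (F.P K) K),
      ∀ᵐ W ∂(fieldMeasure (F.P K) K (Matrix.specialUnitaryGroup (Fin 2) ℂ)),
        (inputOfAC 𝔠.lane (h.pkgAt γ hγ hγ1 K).X (h.pkgAt γ hγ hγ1 K).𝔖).W.mass K r W ≤ s K * Real.exp A₁)
    (hMain : ∃ Cm : ℝ, ∀ (K : ℕ) (W : GaugeField (F.P K) K (Matrix.specialUnitaryGroup (Fin 2) ℂ)),
      PlaqSmall (θBal F.L γ 𝔠.b₀ 𝔠.p₀ 0) W →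
        (h.dataT3 γ hγ hγ1 π).mainT K K ((h.dataT3 γ hγ hγ1 π).triv K K) W ≤ Cm) :
    ∃ Cl' : ℝ, ∀ K : ℕ, ∀ᵐ V ∂fieldMeasure (F.P K) K (Matrix.specialUnitaryGroup (Fin 2) ℂ),
      emlDensity F γ K K V ≤
        s K * (Real.exp Cl' * partitionFn (G := Matrix.specialUnitaryGroup (Fin 2) ℂ) (F.P K) ((F.scheme ℰp γ).β K)) :=
  unitEnvelope_of_halves_slack F hγ.le s (fun K => (hs K).le) (fun K => (h.dataT3 γ hγ hγ1 π).Ecst K K)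
    (h.ae_emlDensity_top_le_slack_of_hlfSlack γ hγ hγ1 π s hs
      (h.hlfSlack_of_slackMassEnvelopeAll γ hγ hγ1 π s (fun K => (hs K).le) hEnv))
    (h.exp_Ecst_le_partitionFn_of_package_of_main γ hγ hγ1 π hMain)

/-! ## §5 The exponential slack `s_K = e^{A₂K}`: from hJ♭-for-every-history, from hTop♭, from hPI♭ -/

omit π in
/-- **`e^{A₁ + A₂K} ≤ e^{A₂⁺K}·e^{A₁}`**: a `K`-linear log-envelope on every history is a mass envelope with the slack `s_K := e^{A₂⁺·K}`, `A₂⁺ = max A₂ 0 ≥ 0`. [folklore] -/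
theorem _root_.Summit.QuantumFields.YangMills.Theorems.AlphaInputsT3AC.Of.slackMassEnvelopeAll_of_growingMassEnvelopeAll
    (hEnv : ∃ A₁ A₂ : ℝ, ∀ (K : ℕ) (r : Hist (F.P K) K),
      ∀ᵐ W ∂(fieldMeasure (F.P K) K (Matrix.specialUnitaryGroup (Fin 2) ℂ)),
        (inputOfAC 𝔠.lane (h.pkgAt γ hγ hγ1 K).X (h.pkgAt γ hγ hγ1 K).𝔖).W.mass K r W ≤ Real.exp (A₁ + A₂ * K)) :
    ∃ A₂ : ℝ, 0 ≤ A₂ ∧ ∃ A₁ : ℝ, ∀ (K : ℕ) (r : Hist (F.P K) K),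
      ∀ᵐ W ∂(fieldMeasure (F.P K) K (Matrix.specialUnitaryGroup (Fin 2) ℂ)),
        (inputOfAC 𝔠.lane (h.pkgAt γ hγ hγ1 K).X (h.pkgAt γ hγ hγ1 K).𝔖).W.mass K r W ≤ Real.exp (A₂ * (K : ℝ)) * Real.exp A₁ := by
  obtain ⟨A₁, A₂, hA⟩ := hEnv
  refine ⟨max A₂ 0, le_max_right _ _, A₁, fun K r => ?_⟩
  filter_upwards [hA K r] with W hW
  refine hW.trans ?_
  rw [← Real.exp_add]
  apply Real.exp_le_exp.mpr
  have := mul_le_mul_of_nonneg_right (le_max_left A₂ 0) (Nat.cast_nonneg K)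
  linarith

/-- ★★★ **THE UNIT ENVELOPE WITH EXPONENTIAL SLACK, PER `(F, γ)`, FROM THE (α) SOCKET, THE MAIN-TERM ROW AND hJ♭-FOR-EVERY-HISTORY**:
`∃ Cl A₂, 0 ≤ A₂ ∧ ∀ K, ρ_K ≤ e^{A₂K}·(e^{Cl}·Z_K)` `dV_K`-a.e. — §4 at `s_K := e^{A₂⁺K}`.  This is the per-`(F, γ)` body of the `hLowExp` letter of LEAD's K-24 door
✓`UnitScaleTiltPinnedHeightTailDoorExpSlack.pinnedHeightTail_of_exp'`. [cite: Balaban1985UV3, Thm 1 (5)–(6) pp.256–257, (41) p.266, (46)–(47) p.267, pp.273–274] -/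
theorem _root_.Summit.QuantumFields.YangMills.Theorems.AlphaInputsT3AC.Of.unitEnvelopeExp_of_growingMassEnvelopeAll_of_main
    (hEnv : ∃ A₁ A₂ : ℝ, ∀ (K : ℕ) (r : Hist (F.P K) K),
      ∀ᵐ W ∂(fieldMeasure (F.P K) K (Matrix.specialUnitaryGroup (Fin 2) ℂ)),
        (inputOfAC 𝔠.lane (h.pkgAt γ hγ hγ1 K).X (h.pkgAt γ hγ hγ1 K).𝔖).W.mass K r W ≤ Real.exp (A₁ + A₂ * K))
    (hMain : ∃ Cm : ℝ, ∀ (K : ℕ) (W : GaugeField (F.P K) K (Matrix.specialUnitaryGroup (Fin 2) ℂ)),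
      PlaqSmall (θBal F.L γ 𝔠.b₀ 𝔠.p₀ 0) W →
        (h.dataT3 γ hγ hγ1 π).mainT K K ((h.dataT3 γ hγ hγ1 π).triv K K) W ≤ Cm) :
    ∃ (Cl A₂ : ℝ), 0 ≤ A₂ ∧ ∀ K : ℕ, ∀ᵐ V ∂(fieldMeasure (F.P K) K (Matrix.specialUnitaryGroup (Fin 2) ℂ)),
      emlDensity F γ K K V ≤
        Real.exp (A₂ * K) * (Real.exp Cl * partitionFn (G := Matrix.specialUnitaryGroup (Fin 2) ℂ) (F.P K) ((F.scheme ℰp γ).β K)) := by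
  obtain ⟨A₂, hA₂, hE⟩ := h.slackMassEnvelopeAll_of_growingMassEnvelopeAll γ hγ hγ1 hEnv
  obtain ⟨Cl', hCl⟩ := h.unitEnvelopeSlack_of_slackMassEnvelopeAll_of_main γ hγ hγ1 π (fun K => Real.exp (A₂ * (K : ℝ)))
    (fun K => Real.exp_pos _) hE hMain
  exact ⟨Cl', A₂, hA₂, hCl⟩

/-- ★★★ **THE UNIT ENVELOPE WITH EXPONENTIAL SLACK FROM THE (α) SOCKET, `hMain` AND hTop♭** — the top-level kinematic letter with a RUN-LINEAR exponent «every segment of the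
family's pinned block averaging ending at the unit torus pushes Haar to `≤ e^{c₀ + c₁K}`·Haar»: ✓`AlphaInputsT3AC.Of.growingMassEnvelopeAll_of_growingTopHaarPushforward` then the
previous theorem. [cite: Balaban1985UV3, Thm 1 (5)–(6) pp.256–257, (41) p.266, (47) p.267; Balaban1987RG1, (0.11) p.253] -/
theorem _root_.Summit.QuantumFields.YangMills.Theorems.AlphaInputsT3AC.Of.unitEnvelopeExp_of_growingTopHaarPushforward_of_main
    (hTop : ∃ c₀ c₁ : ℝ, ∀ (K j n : ℕ), j + n = K →
      (fieldMeasure (F.P K) j (Matrix.specialUnitaryGroup (Fin 2) ℂ)).map (iterFrom (avT3 F K) j n) ≤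
        ENNReal.ofReal (Real.exp (c₀ + c₁ * (K : ℝ))) • fieldMeasure (F.P K) (j + n) (Matrix.specialUnitaryGroup (Fin 2) ℂ))
    (hMain : ∃ Cm : ℝ, ∀ (K : ℕ) (W : GaugeField (F.P K) K (Matrix.specialUnitaryGroup (Fin 2) ℂ)),
      PlaqSmall (θBal F.L γ 𝔠.b₀ 𝔠.p₀ 0) W →
        (h.dataT3 γ hγ hγ1 π).mainT K K ((h.dataT3 γ hγ hγ1 π).triv K K) W ≤ Cm) :
    ∃ (Cl A₂ : ℝ), 0 ≤ A₂ ∧ ∀ K : ℕ, ∀ᵐ V ∂(fieldMeasure (F.P K) K (Matrix.specialUnitaryGroup (Fin 2) ℂ)),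
      emlDensity F γ K K V ≤
        Real.exp (A₂ * K) * (Real.exp Cl * partitionFn (G := Matrix.specialUnitaryGroup (Fin 2) ℂ) (F.P K) ((F.scheme ℰp γ).β K)) :=
  h.unitEnvelopeExp_of_growingMassEnvelopeAll_of_main γ hγ hγ1 π
    (h.growingMassEnvelopeAll_of_growingTopHaarPushforward γ hγ hγ1 hTop) hMain

/-- ★★ **THE UNIT ENVELOPE WITH EXPONENTIAL SLACK FROM THE (α) SOCKET, `hMain` AND hPI♭** (the all-levels twin; ✓`…growingMassEnvelopeAll_of_growingPartialIterates`).
[cite: Balaban1985UV3, Thm 1 (5)–(6) pp.256–257, (41) p.266, (47) p.267; Balaban1985Averaging, (15) p.19] -/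
theorem _root_.Summit.QuantumFields.YangMills.Theorems.AlphaInputsT3AC.Of.unitEnvelopeExp_of_growingPartialIterates_of_main
    (hPI : ∃ c₀ c₁ : ℝ, ∀ (K : ℕ) (ι : ∀ j k : ℕ, Measure (GaugeField (F.P K) k (Matrix.specialUnitaryGroup (Fin 2) ℂ))),
      (∀ j, ι j j = fieldMeasure (F.P K) j (Matrix.specialUnitaryGroup (Fin 2) ℂ)) →
      (∀ j k, j ≤ k → ι j (k + 1) = (ι j k).map (avT3 F K k).avg) →
      ∀ j k, j < k → k ≤ K → ι j k ≤ ENNReal.ofReal (Real.exp (c₀ + c₁ * (K : ℝ))) • fieldMeasure (F.P K) k (Matrix.specialUnitaryGroup (Fin 2) ℂ))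
    (hMain : ∃ Cm : ℝ, ∀ (K : ℕ) (W : GaugeField (F.P K) K (Matrix.specialUnitaryGroup (Fin 2) ℂ)),
      PlaqSmall (θBal F.L γ 𝔠.b₀ 𝔠.p₀ 0) W →
        (h.dataT3 γ hγ hγ1 π).mainT K K ((h.dataT3 γ hγ hγ1 π).triv K K) W ≤ Cm) :
    ∃ (Cl A₂ : ℝ), 0 ≤ A₂ ∧ ∀ K : ℕ, ∀ᵐ V ∂(fieldMeasure (F.P K) K (Matrix.specialUnitaryGroup (Fin 2) ℂ)),
      emlDensity F γ K K V ≤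
        Real.exp (A₂ * K) * (Real.exp Cl * partitionFn (G := Matrix.specialUnitaryGroup (Fin 2) ℂ) (F.P K) ((F.scheme ℰp γ).β K)) :=
  h.unitEnvelopeExp_of_growingMassEnvelopeAll_of_main γ hγ hγ1 π
    (h.growingMassEnvelopeAll_of_growingPartialIterates γ hγ hγ1 hPI) hMain

end Summit.QuantumFields.YangMills.Theorems.UV3UnitEnvelopeSlackOfMassEnvelope

end
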